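import Literature.Geometry.Lorentzian.KerrSeparatedPotentialCriticalPoints
import HarnessLib

/-!
# Partition of `(r₊, b]` into at most eight intervals of strict monotonicity of
# Carter's potential `V = V₀ + V₁` on subextremal Kerr

(family `gr`, infrastructure for statement **gr.S24**; namespace `Literature.Geometry.Lorentzian.Kerr`)

Dafermos–Rodnianski–Shlapentokh-Rothman (*Decay for solutions of the wave equation on Kerr
exterior spacetimes III*, arXiv:1402.7034 = Ann. of Math. 183 (2016)) control in Lemma 6.3.1 the
critical points of the frequency-dependent part `V₀` of Carter's potential; the companion file
`KerrSeparatedPotentialCriticalPoints.lean` records the cruder but frequency-uniform consequence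
for the full potential `V = V₀ + V₁`: for `0 < M`, `|a| < M` and an admissible triple
`(ω, m, Λ)` there is a finite set `S`, `#S ≤ 7`, containing all critical points of `V` in
`(r₊, ∞)` (`Kerr.sepPotential_criticalPoints`), and `V` is strictly monotone on every `[r₁, r₂]`,
`r₁ ≥ r₊`, whose interior avoids the critical points
(`Kerr.sepPotential_strictMonoOn_or_strictAntiOn`).

This file packages the two facts in the form consumed by the Sonin-energy bookkeeping downstream
(an explicit finite partition `t 0 = r₊ < t 1 < ⋯ < t k = b`):

* `exists_partition_avoiding_finset`: an elementary combinatorial lemma — if a property `P r₁ r₂`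
  of subintervals `[r₁, r₂] ⊆ [a, b]` holds whenever the open interval `(r₁, r₂)` contains no
  point of a finite set `S` with `#S ≤ n`, then `[a, b]` splits into `k ≤ n + 1` consecutive
  intervals `[t i, t (i + 1)]`, `t 0 = a < t 1 < ⋯ < t k = b`, each satisfying `P` (induction on
  `n`: cut at the least point of `S` in `(a, b)`);
* `sepPotential_monotone_partition`: for every `b > r₊`, `(r₊, b]` splits into `k ≤ 8` intervals
  `[t i, t (i + 1)]`, `t 0 = r₊ < ⋯ < t k = b`, on each of which `V` is strictly increasing or
  strictly decreasing.

## References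

* M. Dafermos, I. Rodnianski, Y. Shlapentokh-Rothman, arXiv:1402.7034 = Ann. of Math. 183
  (2016), §6.2 (`V = V₀ + V₁`), Lemma 6.3.1 and its proof, §8.4 (decrease)
  (key `DafermosRodnianskiShlapentokhrothman2014`).
-/

noncomputable section

open Set

namespace Literature.Geometry.Lorentzian

namespace Kerr

/-! ### A combinatorial partition lemma -/

/-- The one-piece partition `t 0 = a`, `t 1 = b` of `[a, b]`. [folklore] -/
theorem exists_partition_one {α : Type*} [Preorder α] (P : α → α → Prop) {a b : α}
    (hab : a < b) (h : P a b) (n : ℕ) :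
    ∃ (k : ℕ) (t : ℕ → α), k ≤ n + 1 ∧ t 0 = a ∧ t k = b ∧ (∀ i < k, t i < t (i + 1)) ∧
      ∀ i < k, P (t i) (t (i + 1)) := by
  refine ⟨1, fun i ↦ if i = 0 then a else b, by omega, if_pos rfl, if_neg one_ne_zero,
    fun i hi ↦ ?_, fun i hi ↦ ?_⟩
  · obtain rfl : i = 0 := by omega
    simpa using hab
  · obtain rfl : i = 0 := by omega
    simpa using h

/-- **Partition of `[a, b]` avoiding a finite set.** Let `S` be a finite set in a linear order
with `#S ≤ n`, `a < b`, and `P` a property of pairs `r₁ < r₂` in `[a, b]` which holds as soon as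
the open interval `(r₁, r₂)` contains no point of `S`. Then there are `k ≤ n + 1` and points
`t 0 = a < t 1 < ⋯ < t k = b` with `P (t i) (t (i + 1))` for all `i < k`. (Induction on `n`:
if `S ∩ (a, b) = ∅` take `k = 1`; otherwise cut at the least point `c` of `S ∩ (a, b)`, so that
`P a c`, and partition `[c, b]` avoiding `S \ {c}`.) [folklore] -/
theorem exists_partition_avoiding_finset {α : Type*} [LinearOrder α] (P : α → α → Prop)
    {n : ℕ} {S : Finset α} {a b : α} (hS : S.card ≤ n) (hab : a < b)
    (hP : ∀ r₁ r₂, a ≤ r₁ → r₁ < r₂ → r₂ ≤ b → (∀ x ∈ S, x ∉ Ioo r₁ r₂) → P r₁ r₂) :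
    ∃ (k : ℕ) (t : ℕ → α), k ≤ n + 1 ∧ t 0 = a ∧ t k = b ∧ (∀ i < k, t i < t (i + 1)) ∧
      ∀ i < k, P (t i) (t (i + 1)) := by
  induction n generalizing S a with
  | zero =>
    have hS0 : S = ∅ := Finset.card_eq_zero.mp (Nat.le_zero.mp hS)
    exact exists_partition_one P hab (hP a b le_rfl hab le_rfl (by simp [hS0])) 0
  | succ n ih =>
    by_cases hex : ∃ x ∈ S, a < x ∧ x < b
    · -- cut at the least point `c` of `S ∩ (a, b)`
      obtain ⟨x₀, hx₀S, hax₀, hx₀b⟩ := hex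
      set S' : Finset α := S.filter (fun x ↦ a < x ∧ x < b) with hS'_def
      have hne : S'.Nonempty := ⟨x₀, Finset.mem_filter.mpr ⟨hx₀S, hax₀, hx₀b⟩⟩
      set c : α := S'.min' hne with hc_def
      have hc : c ∈ S' := S'.min'_mem hne
      have hcS : c ∈ S := (Finset.mem_filter.mp hc).1
      have hac : a < c := (Finset.mem_filter.mp hc).2.1
      have hcb : c < b := (Finset.mem_filter.mp hc).2.2
      have hmin : ∀ x ∈ S, a < x → x < b → c ≤ x := fun x hx hax hxb ↦
        S'.min'_le x (Finset.mem_filter.mpr ⟨hx, hax, hxb⟩)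
      -- the first piece `[a, c]`
      have hPac : P a c := hP a c le_rfl hac hcb.le fun x hxS hxI ↦
        (not_lt.mpr (hmin x hxS hxI.1 (hxI.2.trans hcb))) hxI.2
      -- partition `[c, b]` avoiding `S \ {c}`
      obtain ⟨k, t, hk, ht0, htk, hmono, hPt⟩ := ih (S := S.erase c) (a := c)
        (by rw [Finset.card_erase_of_mem hcS]; omega) hcb
        (fun r₁ r₂ hr₁ hr₁₂ hr₂ hx ↦ hP r₁ r₂ (hac.le.trans hr₁) hr₁₂ hr₂ fun x hxS hxI ↦ by
          by_cases hxc : x = c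
          · exact (not_lt.mpr hr₁) (hxc ▸ hxI.1)
          · exact hx x (Finset.mem_erase.mpr ⟨hxc, hxS⟩) hxI)
      refine ⟨k + 1, fun i ↦ if i = 0 then a else t (i - 1), by omega, if_pos rfl, ?_, ?_, ?_⟩
      · simp [htk]
      · intro i hi
        rcases Nat.eq_zero_or_pos i with rfl | hi0
        · simpa [ht0] using hac
        · simp only [if_neg hi0.ne', if_neg (Nat.succ_ne_zero i), Nat.add_sub_cancel]
          have h := hmono (i - 1) (by omega)
          rwa [Nat.sub_add_cancel hi0] at h
      · intro i hi
        rcases Nat.eq_zero_or_pos i with rfl | hi0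
        · simpa [ht0] using hPac
        · simp only [if_neg hi0.ne', if_neg (Nat.succ_ne_zero i), Nat.add_sub_cancel]
          have h := hPt (i - 1) (by omega)
          rwa [Nat.sub_add_cancel hi0] at h
    · -- no point of `S` in `(a, b)`: one piece
      push Not at hex
      exact exists_partition_one P hab
        (hP a b le_rfl hab le_rfl fun x hx hxI ↦ (not_le.mpr hxI.2) (hex x hx hxI.1)) (n + 1)

/-! ### The partition of `(r₊, b]` -/

/-- **`(r₊, b]` splits into at most eight intervals of strict monotonicity of Carter's
potential.** For `0 < M`, `|a| < M`, an admissible frequency triple `(ω, m, Λ)` and every `b > r₊`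
there are `k ≤ 8` and points `t 0 = r₊ < t 1 < ⋯ < t k = b` such that on each `[t i, t (i + 1)]`
the potential `V = V₀ + V₁` is strictly increasing or strictly decreasing: `V` has at most seven
critical points in `(r₊, ∞)` (`sepPotential_criticalPoints`, extending to `V` the count of DRSR
arXiv:1402.7034, Lemma 6.3.1) and is strictly monotone on every `[r₁, r₂]`, `r₁ ≥ r₊`, whose
interior contains none of them (`sepPotential_strictMonoOn_or_strictAntiOn`).
[cite: DafermosRodnianskiShlapentokhrothman2014, Lemma 6.3.1] -/
theorem sepPotential_monotone_partition {M a ω Λ : ℝ} {m : ℤ} (hM : 0 < M)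
    (hMa : IsSubextremal M a) (hadm : IsAdmissibleTriple a ω m Λ) {b : ℝ} (hb : rPlus M a < b) :
    ∃ (k : ℕ) (t : ℕ → ℝ), k ≤ 8 ∧ t 0 = rPlus M a ∧ t k = b ∧ (∀ i < k, t i < t (i + 1)) ∧
      ∀ i < k, StrictMonoOn (sepPotential M a ω m Λ) (Icc (t i) (t (i + 1))) ∨
        StrictAntiOn (sepPotential M a ω m Λ) (Icc (t i) (t (i + 1))) := by
  obtain ⟨S, hS, hcrit⟩ := sepPotential_criticalPoints hM hMa hadm
  exact exists_partition_avoiding_finset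
    (fun r₁ r₂ ↦ StrictMonoOn (sepPotential M a ω m Λ) (Icc r₁ r₂) ∨
      StrictAntiOn (sepPotential M a ω m Λ) (Icc r₁ r₂))
    hS hb fun r₁ r₂ hr₁ _ _ hS' ↦
      sepPotential_strictMonoOn_or_strictAntiOn hM hr₁ fun r hr h0 ↦
        hS' r (hcrit r (hr₁.trans_lt hr.1) h0) hr

end Kerr

end Literature.Geometry.Lorentzian

end
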